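import Summits.Ventures.HodgeRepro.CongruenceHermitianLE

/-!
# The normalisation `Γ ↦ Γ ∩ U(H_K)(𝓞_K)` of ROUTE-C 14.2(c) on the kernel (seat p5)

Blind re-derivation cell `pub-hodge-repro`, seat `p5`.  Every theorem of the congruence chain
(`CongruenceHermitian` … `CongruenceHermitianLE`) takes `Γ(M) ≤ Γ′ ≤ U(H_K)(𝓞_K)`: the group must stabilise the
standard lattice `𝓞_K^{p+1}`.  The route's congruence subgroup `Γ = G(F) ∩ K` need not (ROUTE-C 14.2(c), «silent
hypothesis (ix)» of 13.5); the route replaces `Γ` by `Γ′ := Γ ∩ K_0`, `K_0 = U(H_K)(𝓞_K)`, «a congruence subgroup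
of finite index in `Γ` containing `Γ(M)`».  In the non-adelic vocabulary of the kernel the hypothesis «`K ∩ K_0` is
open in the compact `K`» is the commensurability of `Γ` with `U(H_K)(𝓞_K)` (Mathlib's `Subgroup.Commensurable`, the
definition of an arithmetic subgroup), and the normalisation is three lines:

* **`congrU_le_inf_arithU`** — `Γ(M) ≤ Γ ⇒ Γ(M) ≤ Γ ⊓ U(H_K)(𝓞_K)`;
* **`isFiniteRelIndex_inf_arithU_of_commensurable`** — `Γ` commensurable with `U(H_K)(𝓞_K)` ⇒ `[Γ : Γ ⊓ U(H_K)(𝓞_K)] < ∞`;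
* **`commensurable_arithU_of_congrU_le`** — conversely, `Γ(M) ≤ Γ` (`M ≠ 0`) and `[Γ : Γ ⊓ U(H_K)(𝓞_K)] < ∞` make `Γ`
  commensurable with `U(H_K)(𝓞_K)`: the one-sided finiteness is all the hypothesis says;
* **`lemmaW_all_congruenceCover_ratPointsOf_le_of_commensurable`** — R5's translate chain with every clause
  (`lemmaW_all_congruenceCover_ratPointsOf_le`) for the route's `Γ` itself: `Γ`-invariant `dh_l` restrict to
  `Γ′ = Γ ⊓ U(H_K)(𝓞_K)`, the five clauses hold for `Γ′`, and `Γ″` has finite index in `Γ` (not only in `Γ′`).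

What stays on paper of 14.2(c): «`Γ ∩ K_0` is neat when `Γ` is» and «multiplicities are non-decreasing along the
finite étale cover `S_{Γ ∩ K_0} → S_Γ`» (13.2(a)(i)) — Hodge-theoretic sentences, not typed here.

Nothing here says anything about the status of the Hodge conjecture for CM abelian varieties.
-/

set_option autoImplicit false

noncomputable section

namespace Summit.Ventures.HodgeRepro

namespace CongHerm

open Matrix Filter Topology
open NumberField
open HodgeRepro.BallGen (Idx GLp U Ball unitaryGroupOf ratPointsOf pullback)
open HodgeRepro.BallGen.Inv (IsInvariant)
open HodgeRepro.BallGen.Holo (ballSet actE)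
open HodgeRepro.BallGen.Subm (dcov)
open CongGen

variable {p : ℕ} {K : Type} [Field K] [NumberField K] [IsCMField K]
variable (HK : Matrix (Idx p) (Idx p) K)

/-- `Γ(M) ≤ Γ` implies `Γ(M) ≤ Γ ⊓ U(H_K)(𝓞_K)`: the principal congruence subgroup stabilises the standard
lattice (`congr_le_arith`). -/
theorem congrU_le_inf_arithU {Γ : Subgroup (unitaryGroupOf HK)} {M : 𝓞 K} (hM : congrU HK M ≤ Γ) :
    congrU HK M ≤ Γ ⊓ arithU HK :=
  le_inf hM (congr_le_arith _ _ _ _)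

/-- If `Γ ≤ U(H_K)(K)` is commensurable with `U(H_K)(𝓞_K)`, then `Γ ⊓ U(H_K)(𝓞_K)` has finite index in `Γ`. -/
theorem isFiniteRelIndex_inf_arithU_of_commensurable {Γ : Subgroup (unitaryGroupOf HK)}
    (hΓ : Subgroup.Commensurable Γ (arithU HK)) : (Γ ⊓ arithU HK).IsFiniteRelIndex Γ :=
  ⟨by rw [Subgroup.inf_relIndex_left]; exact hΓ.2⟩

/-- Conversely, a subgroup `Γ ≤ U(H_K)(K)` containing `Γ(M)`, `M ≠ 0`, with `[Γ : Γ ⊓ U(H_K)(𝓞_K)] < ∞` is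
commensurable with `U(H_K)(𝓞_K)`: the other index `[U(H_K)(𝓞_K) : Γ ⊓ U(H_K)(𝓞_K)]` is bounded by
`[U(H_K)(𝓞_K) : Γ(M)] < ∞`. -/
theorem commensurable_arithU_of_congrU_le {Γ : Subgroup (unitaryGroupOf HK)} {M : 𝓞 K} (hM0 : M ≠ 0)
    (hM : congrU HK M ≤ Γ) (hΓ : (Γ ⊓ arithU HK).IsFiniteRelIndex Γ) :
    Subgroup.Commensurable Γ (arithU HK) := by
  haveI : Finite (𝓞 K ⧸ Ideal.span {M}) := BallCong.finite_quotient_span_of_ne_zero hM0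
  have h1 : (congrU HK M).relIndex (arithU HK) ≠ 0 :=
    Subgroup.isFiniteRelIndex_iff_relIndex_ne_zero.mp
      (isFiniteRelIndex_congr (unitaryGroupOf HK) (φO K) (φO_injective (K := K)) M)
  refine ⟨fun h => h1 (Subgroup.relIndex_eq_zero_of_le_left hM h), ?_⟩
  rw [← Subgroup.inf_relIndex_left]
  exact Subgroup.isFiniteRelIndex_iff_relIndex_ne_zero.mp hΓ

variable (φ₀ : K →+* ℂ) (P : GLp p)
  (hP : (P : Matrix (Idx p) (Idx p) ℂ)ᴴ * HK.map φ₀ * (P : Matrix (Idx p) (Idx p) ℂ) = HodgeRepro.BallGen.J p)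

/-- **R5's translate chain for the route's own `Γ` (ROUTE-C 14.2(c) absorbed).**  Let `Γ ≤ U(H_K)(K)` be
commensurable with `U(H_K)(𝓞_K)` and contain `Γ(M)`, `M ≠ 0`; put `Γ′ := Γ ⊓ U(H_K)(𝓞_K)` (so `Γ(M) ≤ Γ′ ≤ U(H_K)(𝓞_K)`
and `[Γ : Γ′] < ∞`), transported to `U(p,1)` by `toUp`.  For `g ≤ p` functions `h_l` analytic near the ball, none
locally constant on it, with `Γ`-invariant differentials `dh_l`, there are rational `γ_1, …, γ_g ∈ ratPointsOf`
such that: on an open dense set of points `z` the map `w ↦ (h_l(γ_l w))_{l<g}` maps every neighbourhood of `z`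
onto a neighbourhood of its value; every entire `H : ℂ^g → ℂ` vanishing on the image of the ball is `0`; each
translate `γ_l^*(dh_l)` is invariant under `Γ″ = Γ′ ⊓ ⨅_l γ_l⁻¹ Γ′ γ_l`; `Γ″` contains the transported `Γ(L)` for
some `L ≠ 0`; `Γ″` has finite index in `Γ′`; and `Γ″` has finite index in `Γ` itself. -/
theorem lemmaW_all_congruenceCover_ratPointsOf_le_of_commensurable {g : ℕ} (hg : g ≤ p)
    {Γ : Subgroup (unitaryGroupOf HK)} (hΓ : Subgroup.Commensurable Γ (arithU HK)) {M : 𝓞 K}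
    (hM0 : M ≠ 0) (hM : congrU HK M ≤ Γ) {h : Fin g → (Fin p → ℂ) → ℂ}
    (hh : ∀ l, AnalyticOnNhd ℂ (h l) (ballSet p)) (hh0 : ∀ l, ∃ w : Ball p, dcov (h l) w.1 ≠ 0)
    (hhΓ : ∀ l, IsInvariant (Γ.map (toUp HK φ₀ P hP)) fun w : Ball p => dcov (h l) w.1) :
    ∃ γ : Fin g → U p, (∀ l, γ l ∈ ratPointsOf φ₀ HK P hP) ∧
      (∃ S : Set (Ball p), IsOpen S ∧ Dense S ∧ ∀ z ∈ S, ∀ U ∈ 𝓝 z.1,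
        (fun w l => h l (actE (γ l) w)) '' U ∈ 𝓝 fun l => h l (actE (γ l) z.1)) ∧
      (∀ H : (Fin g → ℂ) → ℂ, AnalyticOnNhd ℂ H Set.univ →
        (∀ w ∈ ballSet p, H (fun l => h l (actE (γ l) w)) = 0) → H = 0) ∧
      (∀ l, IsInvariant ((Γ ⊓ arithU HK).map (toUp HK φ₀ P hP) ⊓
          ⨅ l, conjSubG (γ l) ((Γ ⊓ arithU HK).map (toUp HK φ₀ P hP)))
        (pullback (γ l) fun w : Ball p => dcov (h l) w.1)) ∧
      (∃ L : 𝓞 K, L ≠ 0 ∧ (congrU HK L).map (toUp HK φ₀ P hP) ≤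
        (Γ ⊓ arithU HK).map (toUp HK φ₀ P hP) ⊓
          ⨅ l, conjSubG (γ l) ((Γ ⊓ arithU HK).map (toUp HK φ₀ P hP))) ∧
      ((Γ ⊓ arithU HK).map (toUp HK φ₀ P hP) ⊓
          ⨅ l, conjSubG (γ l) ((Γ ⊓ arithU HK).map (toUp HK φ₀ P hP))).IsFiniteRelIndex
        ((Γ ⊓ arithU HK).map (toUp HK φ₀ P hP)) ∧
      ((Γ ⊓ arithU HK).map (toUp HK φ₀ P hP) ⊓
          ⨅ l, conjSubG (γ l) ((Γ ⊓ arithU HK).map (toUp HK φ₀ P hP))).IsFiniteRelIndex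
        (Γ.map (toUp HK φ₀ P hP)) := by
  have hΓ' : Γ ⊓ arithU HK ≤ arithU HK := inf_le_right
  have hM' : congrU HK M ≤ Γ ⊓ arithU HK := congrU_le_inf_arithU HK hM
  have hhΓ' : ∀ l, IsInvariant ((Γ ⊓ arithU HK).map (toUp HK φ₀ P hP))
      fun w : Ball p => dcov (h l) w.1 :=
    fun l => (hhΓ l).mono (Subgroup.map_mono inf_le_left)
  obtain ⟨γ, hγ, hsub, hdom, hinv, hlev, hfin⟩ :=
    lemmaW_all_congruenceCover_ratPointsOf_le HK φ₀ P hP hg hΓ' hM0 hM' hh hh0 hhΓ'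
  refine ⟨γ, hγ, hsub, hdom, hinv, hlev, hfin, ⟨?_⟩⟩
  refine Subgroup.relIndex_ne_zero_trans
    (Subgroup.isFiniteRelIndex_iff_relIndex_ne_zero.mp hfin) ?_
  rw [Subgroup.relIndex_map_map_of_injective _ _ (toUp_injective HK φ₀ P hP),
    Subgroup.inf_relIndex_left]
  exact hΓ.2

end CongHerm

end Summit.Ventures.HodgeRepro

end
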